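import Mathlib
import Summits.Ventures.PercRepro2.Defs
import Summits.Ventures.PercRepro2.Harris
import Summits.Ventures.PercRepro2.Graph
import Summits.Ventures.PercRepro2.Events
import Summits.Ventures.PercRepro2.Explore
import Summits.Ventures.PercRepro2.ExploreHalt
import Summits.Ventures.PercRepro2.ExploreHaltDecides
import Summits.Ventures.PercRepro2.CondRecords
import Summits.Ventures.PercRepro2.PSRecords

/-!
# (PS) ≥ (PS_rec) for the concrete exploration of `C(u)` (blind cell PercRepro2, mine-2 g19;
conjectures/MINE-2.md M2-39)

`PSRecords.ps_ge_recForm` needs, for each half, a stopping rule that DECIDES `{u ∈ C_r}` given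
`{a₂ ↮ a₁}`.  p1's halted exploration `Explore.haltRule sel u r` (source `u`, halted when `r` joins,
any selector — `fixedOrder`, `bfs`, `dfs`) decides `{u ↔ r}` outright (`Explore.haltRule_decides`):
on every record, the cylinder lies inside `{u ↔ r}` or inside its complement
(`decidesGiven_haltRule`).  On `Q = {a₂ ↮ a₁}` its records with positive weight are exactly the
records of the exploration halted at the FIRST root that reached `r` (a record reaching the other
root first has `Q ∩ cyl = ∅`), so the two rules `haltRule sel u a₂` / `haltRule sel u a₁` give the
cell's (PS_rec) (ps_records.py: the `fixedOrder` selector in the edge order).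

**`ps_ge_recForm_haltRule`**: `recForm (haltRule sel u a₂) + recForm (haltRule sel u a₁) ≤ ps` —
unconditional, every weight vector, every selector; hence `(PS_rec) ≥ 0 ⟹ (PS) ≥ 0`
(`ps_nonneg_of_recForm_nonneg_haltRule`).  The same holds for the explorations FROM THE ROOTS halted
when `u` joins (`haltRule sel a₂ u`, `haltRule sel a₁ u`; `ps_ge_recForm_haltRule_root`) — a second
record form of (PS).  The sign of either record form is not claimed.
-/

namespace Summit.Ventures.PercRepro2

namespace PSRecords

open CondRecords

section Rule

variable {V : Type*} {E : Type*} [Fintype E] [DecidableEq E] [Fintype V] [DecidableEq V]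
  {ends : E → Sym2 V}

/-- **The halted exploration decides its target on every record**: for every record `T` of
`haltRule sel u r`, `cyl T ⊆ {u ↔ r}` or `cyl T ⊆ {u ↔ r}ᶜ`. -/
theorem cyl_subset_or_disjoint_haltRule (sel : Explore.Selector ends) (u r : V)
    {T : Explore.Record E} (hT : T ∈ (Explore.haltRule sel u r).records) :
    (∀ ω ∈ T.cyl, ω ∈ connEvent ends u r) ∨ (∀ ω ∈ T.cyl, ω ∉ connEvent ends u r) := by
  obtain ⟨ω₀, _, h₀⟩ := Finset.mem_image.1 hT
  by_cases hω₀ : ω₀ ∈ connEvent ends u r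
  · left
    intro ω hω
    have := Explore.haltRule_decides sel u r ω₀ hω₀
    rw [h₀] at this
    exact this hω
  · right
    intro ω hω hωU
    apply hω₀
    have hrec : (Explore.haltRule sel u r).record ω = T := by
      rw [← h₀]
      exact ((Explore.haltRule sel u r).record_eq_iff_mem_cyl ω₀ ω).2 (h₀ ▸ hω)
    have := Explore.haltRule_decides sel u r ω hωU
    rw [hrec, ← h₀] at this
    exact this ((Explore.haltRule sel u r).consistent ω₀)

/-- `haltRule sel u r` decides `{r ↔ u}` given any `Q`. -/
theorem decidesGiven_haltRule (sel : Explore.Selector ends) (u r : V) (Q : Set (Config E)) :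
    DecidesGiven (Explore.haltRule sel u r) Q (connEvent ends r u) := by
  intro T hT
  rw [connEvent_comm ends r u]
  rcases cyl_subset_or_disjoint_haltRule sel u r hT with h | h
  · exact Or.inl fun ω hω _ => h ω hω
  · exact Or.inr fun ω hω _ => h ω hω

variable {R : Type*} [Field R] [LinearOrder R] [IsStrictOrderedRing R]

/-- **(PS) ≥ (PS_rec) for the halted explorations of `C(u)`**: with `rule₁ = haltRule sel u a₂`
(the `a₁`-side functionals, weight `u ∈ C₂`) and `rule₂ = haltRule sel u a₁` (the mirror), for every
weight vector, selector and centring constants. -/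
theorem ps_ge_recForm_haltRule (sel : Explore.Selector ends) {p : E → R} (hp : IsProbVec p)
    (a₁ a₂ u b o : V) (c₁ d₁ c₂ d₂ : R) :
    recForm (Explore.haltRule sel u a₂) p ends a₁ a₂ u b o c₁ d₁ +
        recForm (Explore.haltRule sel u a₁) p ends a₂ a₁ u b o c₂ d₂ ≤
      ps p ends a₁ a₂ u b o c₁ d₁ c₂ d₂ :=
  ps_ge_recForm (Explore.haltRule sel u a₂) (Explore.haltRule sel u a₁) hp ends a₁ a₂ u b o c₁ d₁ c₂ d₂
    (decidesGiven_haltRule sel u a₂ _) (decidesGiven_haltRule sel u a₁ _)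

/-- The exploration of `C(r)` FROM THE ROOT `r`, halted when `u` joins, decides `{r ↔ u}` given any
`Q` (on `Q` its records with positive weight are those of the exploration halted at `u` or the other
root). -/
theorem decidesGiven_haltRule_root (sel : Explore.Selector ends) (r u : V) (Q : Set (Config E)) :
    DecidesGiven (Explore.haltRule sel r u) Q (connEvent ends r u) := by
  intro T hT
  rcases cyl_subset_or_disjoint_haltRule sel r u hT with h | h
  · exact Or.inl fun ω hω _ => h ω hω
  · exact Or.inr fun ω hω _ => h ω hω

/-- **(PS) ≥ the ROOT-exploration record form**: `rule₁ = haltRule sel a₂ u` (explore `C(a₂)` until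
`u` joins, the `a₁`-side functionals), `rule₂ = haltRule sel a₁ u` (the mirror) — a second, different
record form of (PS), also dominated by it. -/
theorem ps_ge_recForm_haltRule_root (sel : Explore.Selector ends) {p : E → R} (hp : IsProbVec p)
    (a₁ a₂ u b o : V) (c₁ d₁ c₂ d₂ : R) :
    recForm (Explore.haltRule sel a₂ u) p ends a₁ a₂ u b o c₁ d₁ +
        recForm (Explore.haltRule sel a₁ u) p ends a₂ a₁ u b o c₂ d₂ ≤
      ps p ends a₁ a₂ u b o c₁ d₁ c₂ d₂ :=
  ps_ge_recForm (Explore.haltRule sel a₂ u) (Explore.haltRule sel a₁ u) hp ends a₁ a₂ u b o c₁ d₁ c₂ d₂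
    (decidesGiven_haltRule_root sel a₂ u _) (decidesGiven_haltRule_root sel a₁ u _)

/-- **(PS_rec) ≥ 0 implies (PS) ≥ 0** for the halted explorations of `C(u)`. -/
theorem ps_nonneg_of_recForm_nonneg_haltRule (sel : Explore.Selector ends) {p : E → R}
    (hp : IsProbVec p) (a₁ a₂ u b o : V) (c₁ d₁ c₂ d₂ : R)
    (h : 0 ≤ recForm (Explore.haltRule sel u a₂) p ends a₁ a₂ u b o c₁ d₁ +
      recForm (Explore.haltRule sel u a₁) p ends a₂ a₁ u b o c₂ d₂) :
    0 ≤ ps p ends a₁ a₂ u b o c₁ d₁ c₂ d₂ :=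
  h.trans (ps_ge_recForm_haltRule sel hp a₁ a₂ u b o c₁ d₁ c₂ d₂)

end Rule

end PSRecords

end Summit.Ventures.PercRepro2
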